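import Summits.HodgeConjecture.HodgeConjecture.Theorems.Ring2AbelianAllStandardAPencils
import Summits.HodgeConjecture.HodgeConjecture.Theorems.Ring2AbelianAllCMJunction
import Literature.AlgebraicGeometry.Abdulali1994.LefschetzStandardATransport
import HarnessLib

/-!
# Ring 2 · §AbelianAll (seat `ab-andre-1`), XIV-b — the transport ROWS on the `A`-node: Abdulali p. 1122 /
# Milne 2020 Prop. 1 WITH THE HYPOTHESIS AS PRINTED (`h₈A`) feeds `HC_CM ∧ A_pen^CM ⟹ HC_AV`, and the KIND column

HONEST FRAMING: research route, not a corollary; conditional on HC_CM plus one named minimal statement.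
(Cell line: research route conditional on HC_CM; not a corollary; Q11.4-sentence-2 already refuted in dim ≥ 3.)

Cell `pub-hodge-ring2`, sub-cell `pub-hodge-ring2-ab-*` (ALL ABELIAN VARIETIES), seat `ab-andre-1`, gen 26; sequel
of part XIV (`Ring2AbelianAllStandardAPencils`: the nodes A_pen∀ = `CompactAbelianPencilStandardA`, A_pen^CM =
`CMPointedPencilStandardA`, `B ⇒ A` on the carriers, rungs `d ≤ 2`, on-path). `HC_CM` =
`Theses.RankFourFaces.CMAbelianHodge` (stmt-HodgeConjecture-3052), a BINDER (and, in the KIND-1 honesty rows, a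
CONCLUSION); `HC_AV` = `Theses.PadicSemiregularLift.HodgeAbelianVarieties` (stmt-1333); the item
`Theses.RankFourFaces.CMToAbelian` (stmt-16267) is OPEN and NOT closed here. Nothing below proves a case of the
Hodge conjecture. The printed theorems enter as NAMED FACTS displayed as binders: `h₈A` =
`Abdulali1994_invariantCycles_of_lefschetzStandardA` (Abdulali 1994 p. 1122 / Milne 2020 Prop. 1 with the
hypothesis AS PRINTED: Grothendieck's `A(𝒳, L)` for every polarisation class of the pencil total space; file
`Literature/AlgebraicGeometry/Abdulali1994/LefschetzStandardATransport`), `h₂₁`, `h₂₂` = André's Lemmes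
6.3.1–6.3.3, `J^{CM}` = the cell's junction (part II, a `def` entered only as a hypothesis). No statement minted
in this cell is cited as a fact.

## What is PROVED here (kernel-checked, sorry-free)

* §D `h₈A ⟹ h₈`: the fact with print's hypothesis implies the cell's `⋆_L`-form fact (`B ⇒ A` on the total
  space, part XIV §0); the converse is not claimed.
* §E ROWS: `h₈A → A_pen∀ → CompactAbelianPencilVHC`, `h₈A → A_pen^CM → CMPointedCompactPencilVHC → CMFibreTransport`;
  (KIND 2 AS TYPED, `HC_CM` load-bearing) `h₈A → h₂₁ → HC_CM → A_pen^CM → HC_AV` and the item reading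
  `→ CMToAbelian`; (KIND 1 HONESTY) `h₈A → J^{CM} → A_pen^CM → HC_CM`, and `h₈A → h₂₁ → h₂₂ → A_pen∀ → HC_AV ∧ HC_CM`
  — the columns parts I–III record for the `⋆_L`-node (5), one node lower on André's axis.

## What is NOT claimed

`A_pen^CM` minimal; `A_pen^CM` strictly weaker than (5); `h₈A` a theorem of the tree (it is a named fact; its
printed proof needs the `θ_n`-weight splitting of the Leray filtration and summand-wise Poincaré duality on the
real carriers).

## References

* [Abdulali1994FamiliesAV] S. Abdulali, Canad. J. Math. 46 (1994), p. 1122 and Lemma 6.2 (p. 1131).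
* [Milne2020HodgeClassesAV] J. S. Milne, Hodge classes on abelian varieties (2020), Prop. 1 (p. 7), Thm. 4, Rem. 3.
* [Andre1996Motifs] Y. André, Publ. Math. IHÉS 83 (1996), Lemmes 6.3.1–6.3.3, Remarque 2 (pp. 31–33).
* [Grothendieck1968] A. Grothendieck, Standard conjectures on algebraic cycles (Bombay 1968), §3 p. 196.
-/

noncomputable section

set_option linter.dupNamespace false

namespace Summit.HodgeConjecture.HodgeConjecture.Ring2.AbelianAll

open CategoryTheory AlgebraicGeometry MonoidalCategory
open Literature.AlgebraicGeometry Literature.AlgebraicGeometry.Motives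
open Literature.AlgebraicGeometry.HodgeTheory
open Literature.AlgebraicGeometry.Abdulali1994 (InvariantCyclesHoldFor
  Abdulali1994_invariantCycles_of_lefschetzStandard Abdulali1994_invariantCycles_of_lefschetzStandardA)
open Literature.AlgebraicGeometry.Andre1996 (andre1996_cmAnchoredPencil
  andre1996_cmHodgeClasses_algebraicallyAnchoredPencils)
open Summit.HodgeConjecture.HodgeConjecture
open Summit.HodgeConjecture.HodgeConjecture.Theses
open Summit.HodgeConjecture.HodgeConjecture.Ring2.Deform (CompactAbelianPencilVHC CMPointedCompactPencilVHC)

/-! ## §D The new fact implies the old one -/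

/-- **`h₈A ⟹ h₈`**: Abdulali's proposition with the hypothesis as printed (`A(𝒳, η)` for every polarisation class)
implies its `⋆_L`-form rendering (hypothesis `B(𝒳)`), by `B ⇒ A` on the total space (part XIV §0). The converse between the
two facts is not claimed. [cite: Milne2020HodgeClassesAV, Prop. 1 (p. 7)] [cite: Grothendieck1968, §3 p. 196 (B(X) ⇒ A(X))] -/
theorem abdulali_lefschetzStandard_of_standardConjectureA (h : Abdulali1994_invariantCycles_of_lefschetzStandardA) :
    Abdulali1994_invariantCycles_of_lefschetzStandard :=
  fun _ _ _ f hf hB ↦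
    h f hf (forall_standardConjectureA_of_forall_standardConjectureBStar hf.isSmoothProjective_total hB)

/-! ## §E Rows on the `A`-node -/

/-- **A_pen∀ ⟹ CompactAbelianPencilVHC** granted `h₈A`. [cite: Abdulali1994FamiliesAV, p. 1122] [cite: Milne2020HodgeClassesAV, Prop. 1 (p. 7)] -/
theorem compactAbelianPencilVHC_of_abdulaliA_of_compactAbelianPencilStandardA
    (h₈A : Abdulali1994_invariantCycles_of_lefschetzStandardA) (hA : CompactAbelianPencilStandardA) :
    CompactAbelianPencilVHC :=
  fun _ _ _ f hf ↦ h₈A f hf (hA f hf)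

/-- **A_pen^CM ⟹ CPVHC_CM** granted `h₈A`. [cite: Abdulali1994FamiliesAV, p. 1122] [cite: Milne2020HodgeClassesAV, Prop. 1 (p. 7)] -/
theorem cmPointedCompactPencilVHC_of_abdulaliA_of_cmPointedPencilStandardA
    (h₈A : Abdulali1994_invariantCycles_of_lefschetzStandardA) (hA : CMPointedPencilStandardA) :
    CMPointedCompactPencilVHC :=
  fun _ _ _ f hf hCM ↦ h₈A f hf (hA f hf hCM)

/-- **A_pen^CM ⟹ T_CM^→ = (4) `CMFibreTransport`** granted `h₈A`. [cite: Abdulali1994FamiliesAV, p. 1122 and Lemma 6.2 (p. 1131)] -/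
theorem cmFibreTransport_of_abdulaliA_of_cmPointedPencilStandardA
    (h₈A : Abdulali1994_invariantCycles_of_lefschetzStandardA) (hA : CMPointedPencilStandardA) : CMFibreTransport :=
  cmFibreTransport_of_cmPointedCompactPencilVHC (cmPointedCompactPencilVHC_of_abdulaliA_of_cmPointedPencilStandardA h₈A hA)

/-- **(KIND 2 AS TYPED, `HC_CM` LOAD-BEARING) `HC_CM` plus `A(𝒳, η)` on the CM-pointed compact abelian pencils gives
`HC_AV`**, granted Abdulali p. 1122 with the hypothesis as printed (`h₈A`) and Lemme 6.3.1 (`h₂₁`): A_pen^CM gives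
transport along those pencils, and deform VI `HC_AV_of_andre1996_of_HC_CM_of_cmPointedCompactPencilVHC` transports
the CM case to every abelian variety. The same row as part I's for (5), one node lower on André's axis.
[cite: Andre1996Motifs, Lemme 6.3.1 (p. 31) and Remarque 2 (p. 33)] [cite: Abdulali1994FamiliesAV, p. 1122]
[cite: Milne2020HodgeClassesAV, Prop. 1 (p. 7) and Thm. 4] -/
theorem HC_AV_of_abdulaliA_of_andre1996_of_HC_CM_of_cmPointedPencilStandardA
    (h₈A : Abdulali1994_invariantCycles_of_lefschetzStandardA) (h₂₁ : andre1996_cmAnchoredPencil)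
    (hCM : RankFourFaces.CMAbelianHodge) (hA : CMPointedPencilStandardA) :
    PadicSemiregularLift.HodgeAbelianVarieties :=
  Deform.HC_AV_of_andre1996_of_HC_CM_of_cmPointedCompactPencilVHC h₂₁ hCM
    (cmPointedCompactPencilVHC_of_abdulaliA_of_cmPointedPencilStandardA h₈A hA)

/-- The item reading: granted `h₈A` and `h₂₁`, `A_pen^CM ⟹ CMToAbelian` (stmt-HodgeConjecture-16267,
`HC_CM → ∀ A, IsSmoothProjective → HodgeConjectureFor`); nothing closes the item. [cite: Andre1996Motifs, Remarque 2 (p. 33)] -/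
theorem cmToAbelian_of_abdulaliA_of_andre1996_of_cmPointedPencilStandardA
    (h₈A : Abdulali1994_invariantCycles_of_lefschetzStandardA) (h₂₁ : andre1996_cmAnchoredPencil)
    (hA : CMPointedPencilStandardA) : RankFourFaces.CMToAbelian :=
  fun hCM A _ ↦ HC_AV_of_abdulaliA_of_andre1996_of_HC_CM_of_cmPointedPencilStandardA h₈A h₂₁ hCM hA A

/-- **(KIND 1 HONESTY) A_pen^CM DOMINATES `HC_CM`, modulo `J^{CM}` and `h₈A`**: through (4) (above) and part II
`HC_CM_of_junctionCM_of_cmFibreTransport` — in print `HC_CM` is idle on this node too.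
[cite: Andre1996Motifs, Lemmes 6.3.2–6.3.3 and Remarque 2 (pp. 32–33)] [cite: Abdulali1994FamiliesAV, p. 1122] -/
theorem HC_CM_of_abdulaliA_of_junctionCM_of_cmPointedPencilStandardA
    (h₈A : Abdulali1994_invariantCycles_of_lefschetzStandardA) (hJ : JunctionCM) (hA : CMPointedPencilStandardA) :
    RankFourFaces.CMAbelianHodge :=
  HC_CM_of_junctionCM_of_cmFibreTransport hJ (cmFibreTransport_of_abdulaliA_of_cmPointedPencilStandardA h₈A hA)

/-- **(KIND 1, `HC_CM` IDLE) A_pen∀ ALONE gives `HC_AV` and `HC_CM`**, granted `h₈A` and Lemmes 6.3.1–6.3.3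
(`h₂₁`, `h₂₂`) — Milne 2020 Thm. 4 "[Abdulali, André]" in kernel form with the Lefschetz hypothesis as printed.
[cite: Milne2020HodgeClassesAV, Thm. 4 and Rem. 3] [cite: Andre1996Motifs, §6.3 Remarque 2 (p. 33)] [cite: Abdulali1994FamiliesAV, p. 1122] -/
theorem HC_AV_and_HC_CM_of_abdulaliA_of_andre1996_of_compactAbelianPencilStandardA
    (h₈A : Abdulali1994_invariantCycles_of_lefschetzStandardA) (h₂₁ : andre1996_cmAnchoredPencil)
    (h₂₂ : andre1996_cmHodgeClasses_algebraicallyAnchoredPencils) (hA : CompactAbelianPencilStandardA) :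
    PadicSemiregularLift.HodgeAbelianVarieties ∧ RankFourFaces.CMAbelianHodge :=
  ⟨Deform.HC_AV_of_andre1996_of_compactAbelianPencilVHC h₂₁ h₂₂
      (compactAbelianPencilVHC_of_abdulaliA_of_compactAbelianPencilStandardA h₈A hA),
    Deform.HC_CM_of_andre1996_of_compactAbelianPencilVHC h₂₂
      (compactAbelianPencilVHC_of_abdulaliA_of_compactAbelianPencilStandardA h₈A hA)⟩

end Summit.HodgeConjecture.HodgeConjecture.Ring2.AbelianAll

end
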